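import Summits.ResolutionOfSingularities.ResolutionOfSingularities.Theorems.EquisingularLiftEquisingularLiftNatSubmaxLineAlgebra
import HarnessLib

/-!
# [OURS · EL♮] HYPERSURFACES WITH A CODIMENSION-2 LINEAR SUBSPACE OF SUBMAXIMAL MULTIPLICITY, ANY DIMENSION — THE ALGEBRA: the regularity
# engine for `Σ_t y_{l t}·q_t + q₀` and the strict-transform chart lemma in `K[y₀, …, y_N]` (crux `Theses.EquisingularLift.EquisingularLiftNat`,
# stmt-ResolutionOfSingularities-20038; `n = 3`: stmt-…-20148)

[OURS · leafhand-res-equisingularlift-7 g0, 2026-08-31; cell `pub/decomp-res`] AI-produced, weaker than expert review; NOT a statement of any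
manuscript; nothing here proves resolution of singularities in positive characteristic.  DEF-FREE helper; no `sorry`; standard axioms; ZERO named
hypotheses.  The `ℙ³` versions are `SubmaxLine.isRegularRing_quotient_lin` (p822150) and `CuspCone.isRegularRing_strictTransformChart` (p643466);
here the same two lemmas for any number of variables, for the all-dimension version of the submaximal-line family.

* **`isRegularRing_quotient_linN`** — `K[y]/(Σ_t y_{l(t)}·q_t + q₀)` is a regular ring when `l` is injective, the partials `∂_{l t}` kill all `q`'s,
  and `(q_t)_t, q₀` have no common zero in `Kᴺ` (`K = K̄`; Stacks 07PF + Nullstellensatz);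
* **`isRegularRing_strictTransformChartN`** — for `f ∈ K[y]`, a set of centre variables `A` and `i₀`: if Hu's substitution gives
  `f ↦ y_{i₀}ⁿ · f′` with `y_{i₀} ∤ f′` and `K[y]/(f′)` regular, then the chart ring `(K[y]/(f))[Ī/ȳ_{i₀}]` of the blow-up along `(y_a : a ∈ A)`
  is regular (`coordBlowupChartEquiv` + Görtz–Wedhorn 13.96 (2));
* `no_common_zero_aeval_family` — feeding the engine from "the binary forms `(G_t)_t` have no common zero on `ℙ¹`".

References: The Stacks Project 07PF; Görtz–Wedhorn Prop. 13.96; Hu 2025 §5 Prop. 5.3 — through the cited tree files.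
-/

set_option linter.dupNamespace false -- mandated namespace `Summit.<Summit>.<Problem>` of this single-conjunct summit

noncomputable section

open MvPolynomial
open Literature.AlgebraicGeometry.Resolution

namespace Summit.ResolutionOfSingularities.ResolutionOfSingularities.Cruxes.EquisingularLiftNat.Sections

namespace SubmaxLine

variable (K : Type) [Field K]

/-- **The engine, any number of variables**: `K[y]/(Σ_t y_{l t}·q_t + q₀)` is regular when `l` is injective, every `∂_{y_{l t}}` kills every `q`
and `q₀`, and the `q`'s together with `q₀` have no common zero in `Kᴺ` (`K` algebraically closed). [cite: StacksProject, Tag 07PF] -/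
theorem isRegularRing_quotient_linN [IsAlgClosed K] {N : ℕ} {T : Type} [Fintype T] [DecidableEq T] (l : T → Fin N)
    (hl : Function.Injective l) (q : T → MvPolynomial (Fin N) K) (q₀ : MvPolynomial (Fin N) K)
    (hD : ∀ t t', pderiv (l t) (q t') = 0) (hD₀ : ∀ t, pderiv (l t) q₀ = 0)
    (hz : ∀ x : Fin N → K, ¬ ((∀ t, aeval x (q t) = 0) ∧ aeval x q₀ = 0)) :
    IsRegularRing (MvPolynomial (Fin N) K ⧸ Ideal.span {∑ t, X (l t) * q t + q₀}) := by
  refine Summit.ResolutionOfSingularities.ResolutionOfSingularities.Theorems.EquisingularLift.SpecimenQuartic.isRegularRing_quotient_of_derivations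
    (S₀ := K) (∑ t, X (l t) * q t + q₀) fun Q hQ hP => ?_
  by_contra hcon
  push Not at hcon
  have hDt : ∀ t, (pderiv (l t) : Derivation K (MvPolynomial (Fin N) K) (MvPolynomial (Fin N) K)) (∑ t', X (l t') * q t' + q₀) = q t := by
    intro t
    rw [map_add, map_sum, hD₀, add_zero]
    rw [Finset.sum_eq_single t]
    · rw [Derivation.leibniz, pderiv_X_self, hD, smul_zero, zero_add, smul_eq_mul, mul_one]
    · intro t' _ ht'
      rw [Derivation.leibniz, hD, smul_zero, zero_add, pderiv_X_of_ne (fun h => ht' (hl h)), smul_zero]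
    · intro h
      exact absurd (Finset.mem_univ t) h
  have hq : ∀ t, q t ∈ Q := fun t => by simpa [hDt t] using hcon (pderiv (l t))
  have hq₀ : q₀ ∈ Q := by
    have h : q₀ = (∑ t, X (l t) * q t + q₀) - ∑ t, X (l t) * q t := by ring
    rw [h]
    exact Q.sub_mem hP (Q.sum_mem fun t _ => Q.mul_mem_left _ (hq t))
  obtain ⟨M, hM, hQM⟩ := Ideal.exists_le_maximal Q hQ.ne_top
  obtain ⟨x, hx⟩ := (MvPolynomial.isMaximal_iff_eq_vanishingIdeal_singleton (K := K)).mp hM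
  have hev : ∀ r ∈ Q, aeval x r = 0 := fun r hr =>
    (MvPolynomial.mem_vanishingIdeal_singleton_iff x r).mp (hx ▸ hQM hr)
  exact hz x ⟨fun t => hev _ (hq t), hev _ hq₀⟩

/-- **The strict-transform chart lemma, any number of variables** (generalising `CuspCone.isRegularRing_strictTransformChart`): if Hu's
substitution gives `f ↦ y_{i₀}ⁿ · f′` with `y_{i₀} ∤ f′` and `K[y]/(f′)` regular, the chart ring `(K[y]/(f))[Ī/ȳ_{i₀}]` of the blow-up along
`I = (y_a : a ∈ A)` is regular. [cite: GortzWedhorn2020, Prop. 13.96 (2)] [cite: Hu2025, §5 Prop. 5.3] -/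
theorem isRegularRing_strictTransformChartN {N : ℕ} (A : Set (Fin N)) (f f' : MvPolynomial (Fin N) K) (i₀ : Fin N) (n : ℕ)
    (hsubst : coordBlowupSubst K A i₀ f = X i₀ ^ n * f')
    (hndvd : ¬ ((X i₀ : MvPolynomial (Fin N) K) ∣ f'))
    (hreg : IsRegularRing (MvPolynomial (Fin N) K ⧸ Ideal.span {f'})) :
    IsRegularRing (blowupAlgebra ((Ideal.span (X '' A)).map (Ideal.Quotient.mk (Ideal.span {f})))
      (Ideal.Quotient.mk (Ideal.span {f}) (X i₀ : MvPolynomial (Fin N) K))) := by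
  set e := coordBlowupChartEquiv K A i₀ with he
  have halg : ∀ p : MvPolynomial (Fin N) K,
      algebraMap (MvPolynomial (Fin N) K) (blowupAlgebra (Ideal.span (X '' A)) (X i₀ : MvPolynomial (Fin N) K)) p =
        e (coordBlowupSubst K A i₀ p) := fun p =>
    (coordBlowupChartEquiv_coordBlowupSubst K A i₀ p).symm
  have hb : algebraMap (MvPolynomial (Fin N) K) (blowupAlgebra (Ideal.span (X '' A)) (X i₀ : MvPolynomial (Fin N) K)) (X i₀) =
      e (X i₀) := by
    rw [halg, coordBlowupSubst_X_self]
  have hf : algebraMap (MvPolynomial (Fin N) K) (blowupAlgebra (Ideal.span (X '' A)) (X i₀ : MvPolynomial (Fin N) K)) f =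
      algebraMap (MvPolynomial (Fin N) K) (blowupAlgebra (Ideal.span (X '' A)) (X i₀ : MvPolynomial (Fin N) K)) (X i₀) ^ n * e f' := by
    rw [halg, hsubst, map_mul, map_pow, hb]
  have hprime : Prime (algebraMap (MvPolynomial (Fin N) K) (blowupAlgebra (Ideal.span (X '' A)) (X i₀ : MvPolynomial (Fin N) K)) (X i₀)) := by
    rw [hb]
    exact (MulEquiv.prime_iff e.toMulEquiv).mpr X_prime
  have hndvd' : ¬ (algebraMap (MvPolynomial (Fin N) K) (blowupAlgebra (Ideal.span (X '' A)) (X i₀ : MvPolynomial (Fin N) K)) (X i₀) ∣ e f') := by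
    rw [hb]
    intro h
    exact hndvd ((map_dvd_iff e.toMulEquiv).mp h)
  have hmap : Ideal.span {e f'} = (Ideal.span {f'}).map e.toRingEquiv.toRingHom := by
    rw [Ideal.map_span, Set.image_singleton]
    rfl
  haveI : IsRegularRing (blowupAlgebra (Ideal.span (X '' A)) (X i₀ : MvPolynomial (Fin N) K) ⧸ Ideal.span {e f'}) :=
    IsRegularRing.of_ringEquiv (Ideal.quotientEquiv (Ideal.span {f'}) (Ideal.span {e f'}) e.toRingEquiv hmap)
  exact IsRegularRing.of_ringEquiv
    (R := blowupAlgebra (Ideal.span (X '' A)) (X i₀ : MvPolynomial (Fin N) K) ⧸ Ideal.span {e f'})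
    (blowupAlgebra.quotientKerMapQuotientEquiv _ _ hf hprime hndvd')

/-- From "the binary forms `G_t` have no common zero on `ℙ¹`" to "their dehomogenisations `G_t(g)` have no common zero in `Kᴺ`" when a component
of `g` is `1`. [folklore] -/
theorem no_common_zero_aeval_family {N : ℕ} {T : Type} (G : T → MvPolynomial (Fin 2) K)
    (hnc : ∀ v : Fin 2 → K, v ≠ 0 → ¬ ∀ t, MvPolynomial.eval v (G t) = 0)
    (g : Fin 2 → MvPolynomial (Fin N) K) (j₁ : Fin 2) (hg : g j₁ = 1) (x : Fin N → K) :
    ¬ ∀ t, aeval x (aeval g (G t)) = 0 := by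
  intro h
  have hv : (fun j => aeval x (g j)) ≠ 0 := by
    intro h0
    have h1 := congrFun h0 j₁
    simp only [hg, map_one, Pi.zero_apply] at h1
    exact one_ne_zero h1
  refine hnc _ hv fun t => ?_
  have ht := h t
  rw [aeval_aeval_point] at ht
  rw [← coe_aeval_eq_eval]
  exact ht

end SubmaxLine

end Summit.ResolutionOfSingularities.ResolutionOfSingularities.Cruxes.EquisingularLiftNat.Sections

end
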